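import Literature.Barriers.RiemannHypothesis.DavenportHeilbronn
import Literature.NumberTheory.LFunctions.SaiasWeingartner
import Literature.NumberTheory.LFunctions.SaiasWeingartnerLeftProofs
import HarnessLib

/-!
# Towards the discharge of `SaiasWeingartner` (Saias–Weingartner 2009, Theorem 2)

Barrier catalogue `Literature/Barriers/RiemannHypothesis/` (D-0021), companion of
`DavenportHeilbronn.lean`, whose named fact `Literature.Barriers.RiemannHypothesis.SaiasWeingartner`
(Saias–Weingartner 2009, Theorem 2: `≫ T` distinct zeros of `∑_ψ P_ψ(s) L(s, ψ)` in every strip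
`σ₁ < Re s < σ₂`, `1/2 ≤ σ₁ < σ₂ ≤ 1 + η`) is reduced here to TWO named facts of
`Literature/NumberTheory/LFunctions/`, following the first sentence of the printed proof (§4: "If
`σ₁ < 1` then `N'_F(σ₁, σ₂, T) ≫ T` by Theorem 2 of [KK07]. We may thus restrict our attention to
the case `σ₁ ≥ 1`"):

* `Literature.NumberTheory.LFunctions.Pankowski2010_thm1_1_discAnalytic` — hybrid joint
  universality of Dirichlet `L`-functions on discs ([Pankowski2010], Thm. 1.1;
  `HybridJointUniversality.lean`), from which the case `σ₁ < 1` ("Theorem 2 of [KK07]" =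
  [Pankowski2010], Cor. 5.3) is PROVED as
  `Literature.NumberTheory.LFunctions.SaiasWeingartner2009_thm2_left_of_pankowski`
  (`SaiasWeingartnerLeftProofs.lean`);
* `Literature.NumberTheory.LFunctions.SaiasWeingartner2009_thm2_right` — the new part of the
  paper (§4: an `η = η(F) > 0` for the strips with `1 ≤ σ₁ < σ₂ ≤ 1 + η`; `SaiasWeingartner.lean`).

This file PROVES the bridge `SaiasWeingartner_of_pankowski`: the two facts imply the catalogued
fact verbatim (its components `2 ≤ card ι`, primitivity, injectivity of `⟨q i, χ i⟩`, finite
support with a non-zero coefficient are exactly the fields of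
`Literature.NumberTheory.LFunctions.IsSWFamily`, and its conclusion is
`Literature.NumberTheory.LFunctions.HasLinearlyManyZeros (charCombination χ P) σ₁ σ₂` unfolded;
the assembly of the two cases is
`Literature.NumberTheory.LFunctions.saiasWeingartner_thm2_of_pankowski`), so that
`SaiasWeingartner_holds` is the one-liner
`SaiasWeingartner_of_pankowski Pankowski2010_thm1_1_discAnalytic_holds
SaiasWeingartner2009_thm2_right_holds` the moment both facts are discharged.

History (D-0026 split review, 2026-08-15). The case `σ₁ < 1` was first vendored as a separate
named fact `SaiasWeingartner2009_thm2_left` with a bridge `SaiasWeingartner_of_thm2_halves` from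
the two halves (p24043); after its reduction to `Pankowski2010_thm1_1_discAnalytic` that fact
carried no proof obligation of its own and was merged back into this file's obligation (the
bridge from the halves is subsumed by `SaiasWeingartner_of_pankowski`).

## References

* [SaiasWeingartner2009] E. Saias, A. Weingartner, *Zeros of Dirichlet series with periodic
  coefficients*, Acta Arith. 140 (2009), 335–344, Theorem 2 and §4 (read, arXiv:0807.0783).
* [KaczorowskiKulas2006] J. Kaczorowski, M. Kulas, Monatsh. Math. 150, 217–232, Theorem 2 (as
  quoted in [SaiasWeingartner2009], §§1, 4).
* [Pankowski2010] Ł. Pańkowski, Acta Arith. 141 (2010), 59–72, Theorem 1.1 and Cor. 5.3 (read).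
-/

noncomputable section

namespace Literature.Barriers.RiemannHypothesis

open Literature.NumberTheory.LFunctions

/-- **`SaiasWeingartner` from hybrid joint universality and the right half.** The case `σ₁ < 1`
of Theorem 2 is "Theorem 2 of [KK07]", i.e. the consequence
`SaiasWeingartner2009_thm2_left_of_pankowski` of the hybrid joint universality theorem on
discs `Pankowski2010_thm1_1_discAnalytic` ([Pankowski2010], Thm. 1.1; Cor. 5.3); the case
`σ₁ ≥ 1` is §4 of the paper (`SaiasWeingartner2009_thm2_right`); the two are assembled by
`saiasWeingartner_thm2_of_pankowski`, and the catalogued fact is that statement with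
`IsSWFamily`, `charCombination` and `HasLinearlyManyZeros` unfolded.
[cite: SaiasWeingartner2009, Thm. 2 and §4]
[cite: Pankowski2010, Cor. 5.3] -/
theorem SaiasWeingartner_of_pankowski (hU : Pankowski2010_thm1_1_discAnalytic)
    (hr : SaiasWeingartner2009_thm2_right) : SaiasWeingartner := by
  intro ι _ q _ χ P hcard hprim hinj hP
  have hF : IsSWFamily χ P :=
    ⟨hcard, hprim, hinj, fun i ↦ (hP i).1, fun i ↦ (hP i).2⟩
  obtain ⟨η, hη, h⟩ := saiasWeingartner_thm2_of_pankowski hU hr ι q χ P hF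
  refine ⟨η, hη, fun σ₁ σ₂ h₁ h₁₂ h₂ ↦ ?_⟩
  obtain ⟨c, hc, T₀, hT⟩ := h σ₁ σ₂ h₁ h₁₂ h₂
  refine ⟨c, hc, T₀, fun T hT' ↦ ?_⟩
  obtain ⟨Z, hZ, hmem⟩ := hT T hT'
  exact ⟨Z, hZ, fun s hs ↦ hmem s hs⟩

end Literature.Barriers.RiemannHypothesis
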